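import Summits.ResolutionOfSingularities.ResolutionOfSingularities.Theorems.MarkedTransferCampaignW46MohWindowSurface
import HarnessLib

/-!
# [OURS · L1 W4.6 rung (iii)] THE PERFECT-BASE-FIELD SLICES of the tame surface-window rung — repair (i) of OURS-desk #117 as NAMED
# decls (statement-only typing + nesting; sibling LEAF of `…W46MohWindowSurface.lean` v4 p502106, kept out of that file for the
# 400-line rule)

Everything here is OURS. Lane A res-L1-ref-a3 05:38:35Z («[PerfectField K] on the §5 regimes/rungs by pure append»), lane B
res-L1-ref-b2 05:33:27Z (fix (i)) and res-plan-2's SLOT-PLANNER WORD 05:33:54Z (preference (i)) on OURS-desk #117: the §5 tame clause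
of `CampaignW46.MohWindowSurfaceTameAt` excludes only κ-RATIONAL heavy roots, so over an IMPERFECT `K` inseparable-heavy states are
admitted (witness `z^p + (x^p − t·y^p)(x + y)` over `𝔽_p(t)`, both lanes). Over a PERFECT `K` the residue field of every closed point
of a finite-type `K`-scheme is a finite, hence perfect, extension of `K`; every root of the residue binary form is separable; «no
κ-rational linear factor of multiplicity `≥ b`» IS «no heavy root» — the commissioned TAME rung exactly. This file types that slice:
`Regime.mohWindowSurfaceTamePerfect` and the three rung Props `MohWindowSurfaceTame{Terminates,TerminatesNabla,PermissiblyTerminates}Perfect`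
under `[PerfectField K]`, DEFINITIONALLY the §5 decls restricted to perfect `K` (`Iff.rfl` lemmas), plus nesting. The all-`K` §5 decls
stay as typed (stronger OURS statements; v4 docstrings). Typed by res-L1-type-o1 (OURS typer o1, gen 6, 2026-08-27). Host: MarkedTransfer
`HypersurfaceOrderReduction` (stmt-ResolutionOfSingularities-16155), `--supports … --as helper`. ROUTE-INDEPENDENT. Nothing here is a
statement of Hironaka's manuscript («perfect base field» p.4 l.22–24 is scope only); no typed candidate, no FACT.
VACUITY: as §5 — inhabited (res-D-pv-029's instances p499871 / p502147 live over any `K`, in particular perfect ones); not trivially true.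
AI-WRITTEN; NO expert review; AI review is weaker than expert review.
-/

noncomputable section

set_option linter.dupNamespace false -- mandated namespace of this single-conjunct summit

open CategoryTheory AlgebraicGeometry TopologicalSpace IsLocalRing

namespace Summit.ResolutionOfSingularities.ResolutionOfSingularities.Theorems

namespace CampaignW46

open Literature.AlgebraicGeometry.Resolution
open Literature.AlgebraicGeometry.Hironaka2017.S02Preliminaries
open Literature.AlgebraicGeometry.Hironaka2017.Datum

universe u

variable {n : ℕ} {p : ℕ} [Fact p.Prime] {K : Type u} [Field K] [CharP K p]

/-- [OURS · L1 W4.6 rung (iii)] **Regime «purely inseparable TAME surface window» OVER A PERFECT BASE FIELD** —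
`Regime.mohWindowSurfaceTame` made available only under `[PerfectField K]` (the manuscript's standing convention «perfect base field»
p.4 l.22–24, scope only); there the tame clause of `MohWindowSurfaceTameAt` excludes the WHOLE heavy-root case; replaces the role of the
restriction (iii) of RESCUE-SEED W4.6 in dimension 3, tame case, at every stage; NOT a statement of the manuscript. [folklore] -/
def Regime.mohWindowSurfaceTamePerfect [PerfectField K] : Regime p K :=
  Regime.mohWindowSurfaceTame

/-- Pure logic: the perfect-field regime IS the tame regime (same term). [folklore] -/
theorem Regime.mohWindowSurfaceTamePerfect_iff [PerfectField K] (A : AmbientDatum p K) (E : IdealExponent A.Z) :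
    Regime.mohWindowSurfaceTamePerfect A E ↔ Regime.mohWindowSurfaceTame A E :=
  Iff.rfl

/-- [OURS · L1 W4.6 rung (iii)] **THE COMMISSIONED TAME RUNG, PERFECT `K`** — replaces the role of the termination clause of Th. 16.13
p.87 l.26–28 (CANDIDATE) for the typed Th. 16.6 procedure restricted at every stage to the purely inseparable tame surface window with
isolated singular locus, over a perfect base field: for EVERY `N`, `Rd`, `Terminates N Rd Regime.mohWindowSurfaceTamePerfect`. The
statement res-D-pv-050 AS res-L1-s46-pv-12 attacks within the scope of his hand proof (05:14:22Z); NOT a statement of the manuscript.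
VACUITY: module docstring. [folklore] -/
def MohWindowSurfaceTameTerminatesPerfect (p : ℕ) [Fact p.Prime] (K : Type u) [Field K] [CharP K p] [PerfectField K] : Prop :=
  ∀ (n : ℕ) (N : Notions.{u} n) (Rd : Reading p K N), Terminates N Rd (Regime.mohWindowSurfaceTamePerfect (p := p) (K := K))

/-- [OURS · L1 W4.6 rung (iii)] the ∇-centred twin over perfect `K`; NOT a statement of the manuscript. [folklore] -/
def MohWindowSurfaceTameTerminatesNablaPerfect (p : ℕ) [Fact p.Prime] (K : Type u) [Field K] [CharP K p] [PerfectField K] :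
    Prop :=
  ∀ (n : ℕ) (N : Notions.{u} n) (Rd : Reading p K N), TerminatesNabla N Rd (Regime.mohWindowSurfaceTamePerfect (p := p) (K := K))

/-- [OURS · L1 W4.6 rung (iii)] the résumé-free form over perfect `K` (`PermissiblyTerminates`); NOT a statement of the manuscript.
[folklore] -/
def MohWindowSurfaceTamePermissiblyTerminatesPerfect (p : ℕ) [Fact p.Prime] (K : Type u) [Field K] [CharP K p]
    [PerfectField K] : Prop :=
  PermissiblyTerminates (Regime.mohWindowSurfaceTamePerfect (p := p) (K := K))

/-! ## Pure logic -/

/-- Over perfect `K` the slice IS the §5 Prop (same term). [folklore] -/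
theorem mohWindowSurfaceTameTerminatesPerfect_iff [PerfectField K] :
    MohWindowSurfaceTameTerminatesPerfect p K ↔ MohWindowSurfaceTameTerminates p K :=
  Iff.rfl

/-- Idem for the ∇ twin. [folklore] -/
theorem mohWindowSurfaceTameTerminatesNablaPerfect_iff [PerfectField K] :
    MohWindowSurfaceTameTerminatesNablaPerfect p K ↔ MohWindowSurfaceTameTerminatesNabla p K :=
  Iff.rfl

/-- Idem for the résumé-free form. [folklore] -/
theorem mohWindowSurfaceTamePermissiblyTerminatesPerfect_iff [PerfectField K] :
    MohWindowSurfaceTamePermissiblyTerminatesPerfect p K ↔ MohWindowSurfaceTamePermissiblyTerminates p K :=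
  Iff.rfl

/-- Over perfect `K` the literal-rule slice gives the ∇ slice. [folklore] -/
theorem mohWindowSurfaceTameTerminatesNablaPerfect_of_terminates [PerfectField K] (h : MohWindowSurfaceTameTerminatesPerfect p K) :
    MohWindowSurfaceTameTerminatesNablaPerfect p K :=
  fun n N Rd => terminatesNabla_of_terminates (h n N Rd)

/-- Over perfect `K` the résumé-free slice gives the literal-rule slice. [folklore] -/
theorem mohWindowSurfaceTameTerminatesPerfect_of_permissibly [PerfectField K]
    (h : MohWindowSurfaceTamePermissiblyTerminatesPerfect p K) : MohWindowSurfaceTameTerminatesPerfect p K :=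
  fun _ N Rd => terminates_of_permissiblyTerminates N Rd h

end CampaignW46

end Summit.ResolutionOfSingularities.ResolutionOfSingularities.Theorems

end
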